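import Summits.HodgeConjecture.HodgeConjecture.Cruxes.BlochSeedDiscOne.Anchor
import Summits.HodgeConjecture.HodgeConjecture.Cruxes.BlochSeedDiscOne.H1MirrorChirality

/-!
# Anomaly lens A3 (plan-lens-HodgeAV-anomaly g3) — LEMMA A∪2I♭ (b-legs), TYPED: the abstract conjugation lemma (proved), the
# mirror clause in the support's OWN coordinates (proved faithful to `XresA2IFires ∘ ι_h`), and the survivor instance (`decide`)

HONEST FRAMING. Cruxes-side workfile of ONE crux idea (`Cruxes/BlochSeedDiscOne/Ideas/h1-mirror-chirality.md` v1.2) on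
stmt-HodgeConjecture-18881 = `EightfoldBlochSeeds.BlochSeedDiscOne` (skeleton `Cruxes/BlochSeedDiscOne/Lines/birth.lean`
814a6a70c14e831a, STUB R `stub_rung_pad4_seedAt`). Director-hodge R16.26 (1) «A3 = the typed statement of LEMMA A∪2I♭ as a
`def … : Prop` in a Cruxes-side `.lean` importing `Anchor.lean` (R16.15), BC7 probe pasted — pencil → type, no desk job», written AFTER
the ×1 non-author referee verdict on the pencil memo `Cruxes/BlochSeedDiscOne/LEMMA-A2I-FLAT-b-legs.md` (v1 08da6b55e8599ce8 ∕ v1.1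
6cb65576f2121b14): s4-prove-1 g29 PASS R1–R7 (verdict files `s4push/prove-1/REFEREE-R16-4-LEMMA-A2I-FLAT-b-legs-s4prove1-g29.md`
6910090971689e64 on v1, c076114e35921da8 on v1.1; bus pub-hsemireg l.33092–l.33093). Imports `Anchor.lean` (R16.15 standing instruction;
never `Lines/birth.lean`) and this seat's `H1MirrorChirality.lean` (e1519d1cbcbd; one-way: Cruxes → Ventures, no sibling seat's file).
Everything is about the typed PAD-4 ∕ 𝔅(μ₄) static game of `Summits/Ventures/HSemireg/Pad4Tower*.lean` (`MConfig`, `MConfig.dual h` = ι_h,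
`RuleDMu4Closed`, `XresA2IFires`, `A2IMinusClosed`, `InDiamond h`). NOTHING HERE SAYS THAT HC ∕ HC_CM ∕ HC_AV ∕ H2 = `BlochSeedDiscOne`
HOLDS OR FAILS; HC and HC_AV are NOT proved; HC_CM is a displayed binder of the route and is not used; the crux is not restated or
weakened; census-neutral (no row changes: memo §7 (a)). No `sorry`, no axiom, no `instance`, no notation. kit 0: no job submitted.

CENSUS ROWS READ (bc5-plan g8 card `hodge-bloch-bc5-plan/work/g8/birth-v4.md` v4.21 35df5d8b718bef10): W16 = kit j305149 FAMCORE v2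
(H₁ = RULE-D + {X⁺, A2I⁻}); W17 = gs-eng-2 g53 peel kit j309861 (CASETABLE-peel-d8: `N[ℓ_u]⁴` dies in round 11 by A2I⁻; sole FC survivor
`P[6I+ℓ_u]⁴`); W18 = kit j312296 (W′) `non_pceiling_fc` UNSAT ×2 (kissat 1 242 s + cadical 586 s) and kit j310554 (W) UNSAT ×2; A1 = bc5-plan g8
answer pub-hsemireg l.32876 (a)–(e); OBS-CEILING-UNIT-CELL 5227a11a738754a2; PAD4-BALANCED (24.8) v3.2 ∕ leak9 kit j294229 (memo (5.3)).
◇₁₀ rows W19 j308425 ∕ W22 j313137: not used.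

WHAT IS TYPED WHERE (memo § ↦ decl):
* §2 (i)–(ii) ↦ §1 here. The two EXTERNAL, pencil-refereed inputs are NOT modelled in the tree (the tree has no 𝔅(μ₄) first-order-design ∕
  (E1) cohomology model — `Pad4FirstOrder.Design.H2` is the class-y one-layer model, `Pad4TowerLemmaA2I` docstring), so «`C` supports a
  first-order design with (E1)» is an ABSTRACT PARAMETER `Supp : MConfig → Prop` and the inputs are HYPOTHESES about it:
  `ConjugationPrinciple h Supp` (= s4-ref g78 duality verdict 053729bf5c699325 §2–§3 P1∕P2, ×2: `Supp` is ι_h-stable inside ◇_h) and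
  `Necessary h Supp Φ` with `Φ = RuleDMu4Closed ∧ A2IMinusClosed` (= PAD4-BALANCED §17 v1.1 CLEAN SUFFICIENT FORM ×2 + encoder g77
  0934e975a1632699 + g78 de2cc29a736f52b0, inside the RULE-D-fixed family set of every run of record; memo §4 = why the conjunction).
  **`LemmaA2IFlat h : Prop`** := for every such `Supp`, these two hypotheses imply `Necessary h Supp (RuleDMu4Closed ∧ A2IFlatClosed h)`,
  `A2IFlatClosed h C := A2IMinusClosed (C.dual h)` (memo §0 (1)). PROVED for every even `h` (`lemmaA2IFlat_holds`; two lines: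
  `inDiamond_dual`, `ruleDMu4Closed_dual`) and as an EQUIVALENCE of the two necessities (`necessary_conj_iff`, ι_h² = id); the bundle form
  `Necessary h Supp StaticH1 ↔ Necessary h Supp (StaticH1Mirror h)` (`necessary_staticH1_iff_mirror`). So the Lean content of K1 is
  bookkeeping; the load-bearing items are the referee's (crit-6 L4′), displayed here as binders — typed ≠ endorsed.
* §2 (iii) (h1)–(e4), the clause IN `C`'s OWN COORDINATES = bc5-plan's accepted «v20-mirror» encoder spec (A1 (e)) ↦ §2 here:
  **`A2IFlatFires h C P N P″ σ u f′ v`** (head `P ∈ E₊`, b-partner `N ∈ E₋` ABOVE `P` on `σ` in direction `u` = the NEGATED phase of `P_σ`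
  (`EncDirFlat`), GUARD `d ≤ cabs`, server `P″ ∈ E₊` BELOW `N` on `f′` in direction `v`, escapes over `E₋`) and `A2IFlatClosedOwn h C`;
  PROVED FAITHFUL: `a2iFlatFires_iff : XresA2IFires (C.dual h) (ι_h P) (ι_h N) (ι_h P″) σ u f′ v ↔ A2IFlatFires h C P N P″ σ u f′ v` and
  `a2iFlatClosed_iff_own : A2IFlatClosed h C ↔ A2IFlatClosedOwn h C` — conjunct for conjunct through the point-level dictionary (ι1)–(ι2)
  (`encDir_dual`, `nullBelow_dual`, `onULineBelowEq_dual`, `ray_dual_eq_iff`, `bsub_dual`, `cabs_dual`, and the tree's `uPartner_dual`,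
  `magree_dual`, `magree2_dual`, `isApex_dual`). This is the referee's R4 as a kernel theorem: an encoder that emits `A2IFlatFires` literally emits A♭.
* §5 (the survivor, both ways up) ↦ §3 here, `decide +kernel` on the explicit fragment `flatFrag8` = {E₋ = [8I ∣ x ∣ x ∣ x], E₊ = [x]⁴,
  [8I ∣ 4I+2ℓ_u ∣ x ∣ x]}, `x = 6I+ℓ_u = (7,1,0)`: the A♭₈ clause FIRES at (P = [x]⁴; σ = 0, u = 2 (antipodal); N; f′ = 1, v = 2, P″) while the
  two `A2I` families OF RECORD are CLOSED on the fragment (`A2IMinusClosed`, `A2IPlusClosed`: the chirality of `EncDir`'s sign branch), and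
  ι₈ of the fragment is {E₋ = [ℓ₂]⁴, [O ∣ 2ℓ₂ ∣ ℓ₂ ∣ ℓ₂], E₊ = [O ∣ ℓ₂ ∣ ℓ₂ ∣ ℓ₂]} on which the A2I⁻ clause OF RECORD fires at the floor unit
  `[ℓ₂]⁴` with its own-ray partner and own-direction server — W17's round-11 instance, letter for letter (memo §5, A1 (c)).
  (A fragment, not a RULE-D-closed support: the probe shows WHICH clause the game of record cannot emit, not a census statement.)
* NOT typed here (pencil of record only, referee R5–R7 PASS): §3 demand rows ∕ table (3.4) and §4 «RULE-D supplies (O3)» — the latter is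
  typeable over `RuleDMu4Closed ∧ InDiamond h` as a per-instance apex-shape statement and would be the natural A4 if the desk keys it.

BC7 (run 2026-08-28 ≈18:40Z, `lean check --no-snap bc7/LemmaA2IFlatProbe.lean` 71db7398dae9b735 = this module's text (first commit 4ec7cf5c19ff,
before the alias `LemmaA2IFlatBLegs` was added; the four probed statements are unchanged) + `import HarnessLib.Audit.CruxProbe` +
`#h21_crux_probe` on the four closed instances against summit `Summit.HodgeConjecture.HodgeConjecture.Theses.EightfoldBlochSeeds.BlochSeedDiscOne`,
batteryMs 90000; rc 0, output sha16 3fef3ca7d9fad5f4): `LemmaA2IFlatEight` VERDICT: CLEAN (P1 ok, P2 ok, P2h ok, P3 ok, P5 ok — P1's `exact?`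
does not re-find the in-file proof `lemmaA2IFlatEight_holds` behind the two unfolded layers `LemmaA2IFlat`∕`Necessary`; the statement IS proved
here, by two lines, and is an instrument lemma, not a route crux; the informative batteries are P2∕P2h — the hypotheses `ConjugationPrinciple`,
`Necessary` are neither vacuous nor refutable by the portfolio — and P5: no `C → BlochSeedDiscOne`, no `BlochSeedDiscOne → C`); `LemmaA2IFlatTen`
VERDICT: CLEAN (same table); `A2IFlatFaithful` VERDICT: TAUTOLOGY-SUSPECT (crux.in-tree: P1 `exact?` uses `a2iFlatClosed_iff_own` — BY DESIGN,
proved in this file; P5 ok); `FlatFrag8Witness` VERDICT: CLEAN (P1 ok within budget, P5 ok). No false positive through `Lines/birth.lean`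
(not imported).
-/

namespace Summit.Ventures.HSemireg.Pad4Tower

open Finset

namespace AnomalyLens

/-! ## §1 LEMMA A∪2I♭ — abstract form over a support class `Supp` (memo §2 (i)–(ii)); PROVED -/

/-- a support condition `Φ` is **(E1)-NECESSARY** on the class `Supp` inside ◇_h: every configuration of ◇_h in the class satisfies `Φ`
(memo §2 (ii) «S ⊂ ◇_h supports a first-order design ⇒ Φ(S)»; `Supp` abstract — see the module docstring). -/
def Necessary (h : ℤ) (Supp Φ : MConfig → Prop) : Prop :=
  ∀ C : MConfig, C.InDiamond h → Supp C → Φ C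

/-- the **CONJUGATION PRINCIPLE** for the class `Supp` at height `h` (memo §2 (i); s4-ref g78 053729bf5c699325 §2–§3 P1∕P2, ×2, for
`Supp` = «supports a first-order design with (E1)»: `D ↦ ι_h D := D^∨ + hI`): the class is stable under the literal dual ι_h = `MConfig.dual h`
inside ◇_h. A HYPOTHESIS here, not a theorem of the tree. -/
def ConjugationPrinciple (h : ℤ) (Supp : MConfig → Prop) : Prop :=
  ∀ C : MConfig, C.InDiamond h → Supp C → Supp (C.dual h)

/-- **A♭_h(C)** — the b-leg family: the `A2I⁻` family OF RECORD applied to the `h`-dual support (memo §0 (1): `A2IMinusClosed (C.dual h)`;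
= the `A2I`-member of `StaticH1Mirror h C`). NOT `A2IPlusClosed C` (= `XresA2IClosed (C.dual 0)`, the a-leg family of record). Decidable. -/
abbrev A2IFlatClosed (h : ℤ) (C : MConfig) : Prop := A2IMinusClosed (C.dual h)

/-- **LEMMA A∪2I♭ (b-legs), typed** (memo §2 (ii) with `Φ = RuleDMu4Closed ∧ A2IMinusClosed`): for every support class `Supp` that obeys the
conjugation principle at height `h`, if `RULE-D ∧ A2I⁻` is (E1)-necessary on `Supp` inside ◇_h then so is `RULE-D ∧ A♭_h` — «a firing A♭_h
clause kills the design». The two hypotheses are the pencil-refereed inputs (g78 ×2; §17 v1.1 ×2 + g77 + g78 (P-d) + memo §4); the implication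
is `lemmaA2IFlat_holds` below (even `h`). Nothing about HC ∕ HC_AV ∕ `BlochSeedDiscOne`. -/
def LemmaA2IFlat (h : ℤ) : Prop :=
  ∀ Supp : MConfig → Prop, ConjugationPrinciple h Supp →
    Necessary h Supp (fun C => RuleDMu4Closed C ∧ A2IMinusClosed C) →
      Necessary h Supp (fun C => RuleDMu4Closed C ∧ A2IFlatClosed h C)

/-- the desk's name for the same statement (director-hodge R16.28 (2) «the hypothesis-form typing `def LemmaA2IFlatBLegs : Prop`»): an alias,
parametrised by the height `h`; closed instances `LemmaA2IFlatEight` ∕ `LemmaA2IFlatTen` below. -/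
abbrev LemmaA2IFlatBLegs (h : ℤ) : Prop := LemmaA2IFlat h

/-- **conjugating a necessary condition** (the one-sentence proof of memo §2 (ii)): if `Φ` is necessary on an ι_h-stable class inside ◇_h
(`h` even, so that ι_h ◇_h = ◇_h — `inDiamond_dual`), then so is `Φ ∘ ι_h`. -/
theorem necessary_conj {h : ℤ} (hh : h % 2 = 0) {Supp Φ : MConfig → Prop} (hconj : ConjugationPrinciple h Supp)
    (hΦ : Necessary h Supp Φ) : Necessary h Supp (fun C => Φ (C.dual h)) :=
  fun C hC hS => hΦ (C.dual h) (inDiamond_dual hh hC) (hconj C hC hS)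

/-- … and conversely (ι_h is an involution, `dual_dual`): the two necessities are ONE statement read upside down. -/
theorem necessary_conj_iff {h : ℤ} (hh : h % 2 = 0) {Supp Φ : MConfig → Prop} (hconj : ConjugationPrinciple h Supp) :
    Necessary h Supp Φ ↔ Necessary h Supp (fun C => Φ (C.dual h)) := by
  refine ⟨necessary_conj hh hconj, fun hΦ C hC hS => ?_⟩
  have := necessary_conj hh hconj hΦ C hC hS
  simpa only [dual_dual] using this

/-- **LEMMA A∪2I♭ HOLDS at every even height** (memo §2 (ii) ∎: conjugate, then put RULE-D back in own coordinates by `ruleDMu4Closed_dual`). -/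
theorem lemmaA2IFlat_holds {h : ℤ} (hh : h % 2 = 0) : LemmaA2IFlat h := by
  intro Supp hconj hnec C hC hS
  obtain ⟨hD, hA⟩ := necessary_conj hh hconj hnec C hC hS
  exact ⟨(ruleDMu4Closed_dual h C).1 hD, hA⟩

/-- the alias holds at every even height (= `lemmaA2IFlat_holds`). -/
theorem lemmaA2IFlatBLegs_holds {h : ℤ} (hh : h % 2 = 0) : LemmaA2IFlatBLegs h := lemmaA2IFlat_holds hh

/-- the converse transport: `RULE-D ∧ A♭_h` necessary ⇒ `RULE-D ∧ A2I⁻` necessary (so neither family is «more certified» than the other). -/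
theorem lemmaA2IFlat_converse {h : ℤ} (hh : h % 2 = 0) (Supp : MConfig → Prop) (hconj : ConjugationPrinciple h Supp)
    (hnec : Necessary h Supp (fun C => RuleDMu4Closed C ∧ A2IFlatClosed h C)) :
    Necessary h Supp (fun C => RuleDMu4Closed C ∧ A2IMinusClosed C) := by
  intro C hC hS
  obtain ⟨hD, hA⟩ := necessary_conj hh hconj hnec C hC hS
  refine ⟨(ruleDMu4Closed_dual h C).1 hD, ?_⟩
  simpa only [A2IFlatClosed, dual_dual] using hA

/-- **the bundle form**: `H₁ = RULE-D + {X⁺, A2I⁻}` (`MConfig.StaticH1`) is necessary on `Supp` iff its ι_h-MIRROR `StaticH1Mirror h` is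
(`staticH1_dual_iff`, PROVED in `H1MirrorChirality`). With the census inputs this is what makes `fcFree_of_noLowerFC` bite (memo §7 (b)(d)). -/
theorem necessary_staticH1_iff_mirror {h : ℤ} (hh : h % 2 = 0) {Supp : MConfig → Prop} (hconj : ConjugationPrinciple h Supp) :
    Necessary h Supp MConfig.StaticH1 ↔ Necessary h Supp (StaticH1Mirror h) := by
  rw [necessary_conj_iff hh hconj]
  simp only [staticH1_dual_iff]

/-- closed instance for the BC7 probe: LEMMA A∪2I♭ at the census height `h = 8`. -/
def LemmaA2IFlatEight : Prop := LemmaA2IFlat 8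

/-- closed instance for the BC7 probe: LEMMA A∪2I♭ at `h = 10` (the ◇₁₀ runs W19 ∕ W22). -/
def LemmaA2IFlatTen : Prop := LemmaA2IFlat 10

/-- PROVED. -/
theorem lemmaA2IFlatEight_holds : LemmaA2IFlatEight := lemmaA2IFlat_holds (h := 8) (by decide)

/-- PROVED. -/
theorem lemmaA2IFlatTen_holds : LemmaA2IFlatTen := lemmaA2IFlat_holds (h := 10) (by decide)

/-! ## §2 The A♭_h clause in the support's OWN coordinates (memo §2 (iii) (h1)–(e4)) and its faithfulness; PROVED -/

/-- **the b-direction of a charged letter read through ι_h** (= `EncDir (ι_h x) u` in own coordinates, `encDir_dual`): for `α ≤ h` (always in ◇_h)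
`x = tI + cℓ_ζ` lies `c = cabs x` steps of direction `u` BELOW its UPPER node `(α + c)·I`, i.e. `u = −ζ` (memo (ι1), (h1): «`EncDir` = phase −ζ of
ι_h P_σ»); for `α > h` (never in ◇_h) the own phase. Decidable. -/
abbrev EncDirFlat (h : ℤ) (x : BPoint) (u : Fin 4) : Prop :=
  (x.1 ≤ h ∧ x = ray (x.1 + cabs x, 0, 0) u (-(cabs x))) ∨ (h < x.1 ∧ x = ray (x.1 - cabs x, 0, 0) u (cabs x))

/-- **ONE A♭_h CLAUSE FIRES, in `C`'s own coordinates** (memo §2 (iii); conjunct for conjunct the ι_h-preimage of `XresA2IFires` l.157–169 —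
PROVED below, `a2iFlatFires_iff`): (h1) HEAD `P` (an `E₊`-cell) with `P_σ` charged, `u` its b-direction; (h2) b-PARTNER `N` (an `E₋`-cell) ABOVE
`P` on `σ`, `N_σ = P_σ + d·n_u`, with the GUARD `d ≤ cabs P_σ` whenever `α(P_σ) ≤ h`; `f′ ≠ σ`; (h3) SERVER `P″` (an `E₊`-cell) BELOW `N` on `f′`,
`N_{f′} = P″_{f′} + e·n_v`, `e ≥ 1`; (e1) mirror `A2IPRES`: no `E₋`-cell is above `P` on `σ` in a direction `w ≠ u`; (e2) mirror `inter` + `deeper`: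
every `E₋`-cell above `P` on `σ` in direction `u` is at or above `N`, and none is above `N` on `σ` in direction `u`; (e3) mirror `A1W`: every
`E₋`-cell `M` null-ABOVE `P` on `f′` (leg, or (r2a) cover touching `f′`) has `M_{f′} = P_{f′} + e′·n_v`; (e4) mirror polluter census EMPTY: no
`E₋`-cell `M` agreeing with `P` off `{σ, f′}` with `M_σ` on the `u`-line AT OR ABOVE `N_σ` and either (3b) `M_{f′} = P_{f′} − e″·n_v`, `e″ ≥ 1`,
at or above the level of `P″_{f′}`, or (3d) `M_{f′} − P″_{f′}` effective and `P_{f′} − M_{f′}` spacelike. Decidable. -/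
abbrev A2IFlatFires (h : ℤ) (C : MConfig) (P N P'' : MCell) (σ u f' v : Fin 4) : Prop :=
  ¬ isApex (P σ) ∧ EncDirFlat h (P σ) u ∧ UPartner N P σ u ∧ ((P σ).1 ≤ h → (N σ).1 - (P σ).1 ≤ cabs (P σ)) ∧ f' ≠ σ ∧
    UPartner N P'' f' v ∧
    (∀ M ∈ C.lower, ∀ w : Fin 4, w ≠ u → ¬ UPartner M P σ w) ∧
    (∀ M ∈ C.lower, UPartner M P σ u → (N σ).1 ≤ (M σ).1) ∧
    (∀ M ∈ C.lower, ¬ UPartner M N σ u) ∧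
    (∀ M ∈ C.lower, NullBelow (P f') (M f') →
      (MAgree P M f' ∨ ∃ g : Fin 4, g ≠ f' ∧ MAgree2 P M f' g ∧ NullBelow (P g) (M g)) →
        M f' = ray (P f') v ((M f').1 - (P f').1)) ∧
    (∀ M ∈ C.lower, MAgree2 P M σ f' → OnULineBelowEq (N σ) (M σ) u →
      ¬ ((M f').1 < (P f').1 ∧ (P'' f').1 ≤ (M f').1 ∧ P f' = ray (M f') v ((P f').1 - (M f').1)) ∧
        ¬ (Effective (bsub (M f') (P'' f')) ∧ Spacelike (bsub (P f') (M f'))))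

/-- **A♭_h-CLOSED, in own coordinates**: no clause fires at any head `P ∈ E₊`, partner `N ∈ E₋`, server `P″ ∈ E₊`. Decidable; = `A2IFlatClosed h C`
(`a2iFlatClosed_iff_own`). -/
abbrev A2IFlatClosedOwn (h : ℤ) (C : MConfig) : Prop :=
  ∀ P ∈ C.upper, ∀ N ∈ C.lower, ∀ P'' ∈ C.upper, ∀ σ u f' v : Fin 4, ¬ A2IFlatFires h C P N P'' σ u f' v

/-! ### the point-level dictionary (ι1)–(ι2), complementing `Pad4TowerRuleDMu4Dual` §3 -/

/-- the charge `cabs` is ι_h-invariant. -/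
theorem cabs_dual (h : ℤ) (x : BPoint) : cabs (dualPt h x) = cabs x := by
  obtain ⟨a, b1, b2⟩ := x
  simp [cabs, abs_neg]

/-- **the encoder direction of the dual letter** (memo (ι1)∕(h1); cf. `guardChirality_probe_dual8`): `EncDir (ι_h x) u ↔ EncDirFlat h x u`. -/
theorem encDir_dual (h : ℤ) (x : BPoint) (u : Fin 4) : EncDir (dualPt h x) u ↔ EncDirFlat h x u := by
  unfold EncDir EncDirFlat
  rw [cabs_dual]
  obtain ⟨a, b1, b2⟩ := x
  generalize cabs (a, b1, b2) = c
  fin_cases u <;> simp [ray, dualPt, Prod.ext_iff] <;> omega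

/-- strictly-null-below is reversed by ι_h. -/
theorem nullBelow_dual (h : ℤ) (x y : BPoint) : NullBelow (dualPt h x) (dualPt h y) ↔ NullBelow y x := by
  obtain ⟨x1, x2, x3⟩ := x
  obtain ⟨y1, y2, y3⟩ := y
  simp only [NullBelow]
  constructor
  · rintro ⟨h1, h2⟩
    exact ⟨by omega, by nlinarith [h2]⟩
  · rintro ⟨h1, h2⟩
    exact ⟨by omega, by nlinarith [h2]⟩

/-- a leg equation dualises to the leg equation in the SAME direction index with the endpoints swapped (memo (ι2); the equality half of
`ray_dual_iff`, stated with the α-difference already in own coordinates). -/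
theorem ray_dual_eq_iff (h : ℤ) (x y : BPoint) (k : Fin 4) :
    dualPt h y = ray (dualPt h x) k (x.1 - y.1) ↔ x = ray y k (x.1 - y.1) := by
  obtain ⟨x1, x2, x3⟩ := x
  obtain ⟨y1, y2, y3⟩ := y
  fin_cases k <;> simp [ray, dualPt, Prod.ext_iff] <;> omega

/-- «on the `u`-line at or below» is reversed by ι_h. -/
theorem onULineBelowEq_dual (h : ℤ) (x y : BPoint) (u : Fin 4) :
    OnULineBelowEq (dualPt h x) (dualPt h y) u ↔ OnULineBelowEq y x u := by
  obtain ⟨x1, x2, x3⟩ := x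
  obtain ⟨y1, y2, y3⟩ := y
  fin_cases u <;> simp [OnULineBelowEq, ray, dualPt, Prod.ext_iff] <;> omega

/-- differences are reversed by ι_h: `ι_h x − ι_h y = y − x`. -/
theorem bsub_dual (h : ℤ) (x y : BPoint) : bsub (dualPt h x) (dualPt h y) = bsub y x := by
  obtain ⟨x1, x2, x3⟩ := x
  obtain ⟨y1, y2, y3⟩ := y
  simp only [bsub, Prod.mk.injEq]
  omega

/-- α-comparisons through ι_h. -/
theorem dual_le_dual_iff (h a b : ℤ) : h - a ≤ h - b ↔ b ≤ a := by omega

/-- α-comparisons through ι_h (strict). -/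
theorem dual_lt_dual_iff (h a b : ℤ) : h - a < h - b ↔ b < a := by omega

/-- the guard premise `0 ≤ α(ι_h x)` in own coordinates. -/
theorem dual_nonneg_iff (h a : ℤ) : 0 ≤ h - a ↔ a ≤ h := by omega

/-- the guard depth `α(ι_h P_σ) − α(ι_h N_σ)` in own coordinates. -/
theorem dual_sub_dual (h a b : ℤ) : h - a - (h - b) = b - a := by omega

/-- quantifying over the dual's `P`-cells = quantifying over the own `N`-cells. -/
theorem forall_dual_upper {h : ℤ} {C : MConfig} {φ : MCell → Prop} :
    (∀ Q ∈ (C.dual h).upper, φ Q) ↔ ∀ M ∈ C.lower, φ (dualCell h M) := by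
  constructor
  · intro H M hM
    exact H _ (dualCell_mem_dual_upper hM)
  · intro H Q hQ
    have := H _ (mem_dual_upper.1 hQ)
    rwa [dualCell_dualCell] at this

/-- quantifying over the dual's `N`-cells = quantifying over the own `P`-cells. -/
theorem forall_dual_lower {h : ℤ} {C : MConfig} {φ : MCell → Prop} :
    (∀ Q ∈ (C.dual h).lower, φ Q) ↔ ∀ M ∈ C.upper, φ (dualCell h M) := by
  constructor
  · intro H M hM
    exact H _ (dualCell_mem_dual_lower hM)
  · intro H Q hQ
    have := H _ (mem_dual_lower.1 hQ)
    rwa [dualCell_dualCell] at this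

/-- **FAITHFULNESS OF THE OWN-COORDINATE CLAUSE** (referee item R4 as a kernel theorem): the `A2I⁻` clause OF RECORD fires on the `h`-dual
support at (head `ι_h P`, partner `ι_h N`, server `ι_h P″`; `σ, u, f′, v`) iff the A♭_h clause fires on `C` at (`P`; `σ, u`; `N`; `f′, v`; `P″`). -/
theorem a2iFlatFires_iff (h : ℤ) (C : MConfig) (P N P'' : MCell) (σ u f' v : Fin 4) :
    XresA2IFires (C.dual h) (dualCell h P) (dualCell h N) (dualCell h P'') σ u f' v ↔ A2IFlatFires h C P N P'' σ u f' v := by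
  simp only [XresA2IFires, A2IFlatFires, forall_dual_upper, uPartner_dual, magree_dual, magree2_dual]
  -- point level: `dualCell h X f` unfolds to `dualPt h (X f)`, whose `α`-projection the simplifier computes to `h − α` on its own
  simp only [dualCell, isApex_dual, encDir_dual, cabs_dual, nullBelow_dual, onULineBelowEq_dual, bsub_dual,
    dual_le_dual_iff, dual_lt_dual_iff, dual_nonneg_iff, dual_sub_dual, ray_dual_eq_iff]

/-- **A♭_h = its own-coordinate form** (so an encoder emitting `A2IFlatFires` literally, e.g. bc5-plan's v20-mirror, emits A♭_h). -/
theorem a2iFlatClosed_iff_own (h : ℤ) (C : MConfig) : A2IFlatClosed h C ↔ A2IFlatClosedOwn h C := by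
  simp only [A2IFlatClosed, A2IMinusClosed, XresA2IClosed, A2IFlatClosedOwn, forall_dual_lower, forall_dual_upper,
    a2iFlatFires_iff]

/-- closed instance for the BC7 probe: faithfulness at every height and support. -/
def A2IFlatFaithful : Prop := ∀ (h : ℤ) (C : MConfig), A2IFlatClosed h C ↔ A2IFlatClosedOwn h C

/-- PROVED. -/
theorem a2iFlatFaithful_holds : A2IFlatFaithful := a2iFlatClosed_iff_own

/-! ## §3 Probes (`decide`): the survivor instance, both ways up (memo §5; W17 j309861 round 11, W18 j312296, OBS 5227a11a738754a2, A1 (c)) -/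

section Probes

set_option synthInstance.maxSize 8192
set_option synthInstance.maxHeartbeats 2000000

/-- the survivor letter `x = 6I+ℓ_u = (7,1,0)` (phase index `0`; node `6`, charge `1`, upper node `8I`). -/
def xSurv : BPoint := ray (6, 0, 0) 0 1

/-- the census survivor `P = [x]⁴` (= `survivor8`). -/
def fragP : MCell := mcellOf xSurv xSurv xSurv xSurv

/-- its b-LIFT on factor `0`: `N = P(0 ↦ 8I)` — present on every static support by RULE-D at `P` (LEMMA U-ceiling, g53). -/
def fragN : MCell := mcellOf (8, 0, 0) xSurv xSurv xSurv

/-- the ANTIPODAL SERVER of `N` on factor `1`: `P″ = N(1 ↦ x − n_{−u}) = [8I ∣ 4I+2ℓ_u ∣ x ∣ x]`, `4I+2ℓ_u = (6,2,0)` (memo §5; (24.8)'s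
«ceiling partner column», present 12∕12 on the j288354 witnesses). -/
def fragPpp : MCell := mcellOf (8, 0, 0) (ray (4, 0, 0) 0 2) xSurv xSurv

/-- **the survivor fragment** `{E₋ = {N}, E₊ = {P, P″}}` ⊂ ◇₈ (a fragment of a support, NOT RULE-D-closed). -/
def flatFrag8 : MConfig where
  lower := {fragN}
  upper := {fragP, fragPpp}

/-- the fragment read through ι₈: the FLOOR UNIT `[ℓ₂]⁴` with its own-ray partner `[O ∣ ℓ₂ ∣ ℓ₂ ∣ ℓ₂]` above it … -/
def flatFrag8Dual : MConfig where
  lower := {mcellOf (lpt 1 2) (lpt 1 2) (lpt 1 2) (lpt 1 2), mcellOf (0, 0, 0) (lpt 2 2) (lpt 1 2) (lpt 1 2)}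
  upper := {mcellOf (0, 0, 0) (lpt 1 2) (lpt 1 2) (lpt 1 2)}

/-- **THE SURVIVOR INSTANCE** [kernel, `decide`]: (a) the fragment lies in ◇₈; (b) the A♭₈ clause FIRES at (`P = [x]⁴`; `σ = 0`, `u = 2` = the
antipodal direction; `N = P(0 ↦ 8I)` at guard depth `d = 1 = cabs`; `f′ = 1`, `v = 2`, server `[8I ∣ 4I+2ℓ_u ∣ x ∣ x]`), so the fragment is NOT
A♭₈-closed (own coordinates and, by faithfulness, `A2IMinusClosed (ι₈ ·)`); (c) both `A2I` families OF RECORD are CLOSED on it — `A2I⁻` (no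
`E₋`-head has a partner) and `A2I⁺` (the `0`-dual's `EncDir` picks the a-direction `0`, whose partner `(8,2,0)` is absent and outside ◇₈): the
game of record cannot emit this kill (A1 (b)(c)); (d) ι₈ of the fragment IS `flatFrag8Dual`, on which the `A2I⁻` clause of record fires at the
floor unit `[ℓ₂]⁴` (`σ = 0`, own direction `u = 2`, partner `[O ∣ ℓ₂ ∣ ℓ₂ ∣ ℓ₂]`, `f′ = 1`, `v = 2`, server `[O ∣ 2ℓ₂ ∣ ℓ₂ ∣ ℓ₂]`) — W17's round-11
death of `N[ℓ]⁴`, letter for letter. -/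
theorem flatFrag8_probe :
    flatFrag8.InDiamond 8 ∧
    A2IFlatFires 8 flatFrag8 fragP fragN fragPpp 0 2 1 2 ∧ ¬ A2IFlatClosedOwn 8 flatFrag8 ∧ ¬ A2IFlatClosed 8 flatFrag8 ∧
    A2IMinusClosed flatFrag8 ∧ A2IPlusClosed flatFrag8 ∧
    ((flatFrag8.dual 8).lower = flatFrag8Dual.lower ∧ (flatFrag8.dual 8).upper = flatFrag8Dual.upper) ∧
    XresA2IFires flatFrag8Dual (mcellOf (lpt 1 2) (lpt 1 2) (lpt 1 2) (lpt 1 2)) (mcellOf (0, 0, 0) (lpt 1 2) (lpt 1 2) (lpt 1 2))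
      (mcellOf (0, 0, 0) (lpt 2 2) (lpt 1 2) (lpt 1 2)) 0 2 1 2 := by
  refine ⟨by decide +kernel, by decide +kernel, by decide +kernel, ?_, by decide +kernel, by decide +kernel, by decide +kernel,
    by decide +kernel⟩
  rw [a2iFlatClosed_iff_own]
  decide +kernel

/-- closed instance for the BC7 probe: the survivor-fragment witness «A♭₈ kills where both families of record are closed». -/
def FlatFrag8Witness : Prop := ¬ A2IFlatClosed 8 flatFrag8 ∧ A2IMinusClosed flatFrag8 ∧ A2IPlusClosed flatFrag8

/-- PROVED. -/
theorem flatFrag8Witness_holds : FlatFrag8Witness :=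
  ⟨flatFrag8_probe.2.2.2.1, flatFrag8_probe.2.2.2.2.1, flatFrag8_probe.2.2.2.2.2.1⟩

end Probes

/-! ## §4 DISCHARGEABILITY TABLE for the two binders of `LemmaA2IFlat` (A4-a; critic idea-crit-6 g4 L4⁗ GO, conditions α–δ; director R16.33 (3)
«is any binder dischargeable from landed p610008 ∕ LEMMA T?»). Theorems only — no new `def … : Prop`; §1–§3 above unchanged (append-only).

| binder | class `Supp` | status in tree | by |
|---|---|---|---|
| 1 `ConjugationPrinciple h Supp` | `RuleDMu4Closed` | PROVED, any `h` | `conjugationPrinciple_ruleD` (`ruleDMu4Closed_dual`) |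
| 1 | `MConfig.G1Closed` | PROVED, any `h` | `conjugationPrinciple_g1Closed` (`g1Closed_dual`) |
| 1 | `(·).InDiamond h` | PROVED, `h` even | `conjugationPrinciple_inDiamond` (`inDiamond_dual`) |
| 1 | `S ∧ T`, both dischargeable | PROVED | `conjugationPrinciple_and` |
| 1 | `RuleDMu4Closed ∧ G1Closed ∧ InDiamond 8` | PROVED | `conjugationPrinciple_envelope_eight` |
| 1 | `A2IMinusClosed` (the bare class of record) | **REFUTED at `h = 8`** | `not_conjugationPrinciple_a2iMinus_eight` (witness `flatFrag8`) |
| 1 | the (E1)-design support class (intended) | no kernel model; refereed binder (g78 ×2) | — |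
| 2 `Necessary h Supp (RuleDMu4Closed ∧ A2IMinusClosed)` | any `Supp ⊆` the predicate | PROVED (degenerate) | `necessary_of_subclass` |
| 2 | the (E1)-design support class (intended) | no kernel form; refereed binder (§17 v1.1 ×2 + g77 + g78) | — |

HONESTY LINE (condition β, verbatim in substance): **at `Supp := A2IMinusClosed` Binder 1 is FALSE (`not_conjugationPrinciple_a2iMinus_eight`)
⇒ instantiating LEMMA A∪2I♭ on the bare class of record is VACUOUS; the lemma has content only on ι_h-STABLE envelopes, and the smallest typed
ι₈-stable envelope in the tree is `RuleDMu4Closed ∧ G1Closed ∧ InDiamond 8` (`conjugationPrinciple_envelope_eight`, by `conjugationPrinciple_and`).**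
The refutation IS the chirality: the survivor fragment is A2I⁻-closed and its ι₈-image is not (§3).
WHY p610008 ∕ LEMMA T ∕ LEMMA P DO NOT DISCHARGE ANYTHING HERE: ι_h = (swap E₋ ↔ E₊) ∘ (α ↦ h − α) ∘ (Δ² on all four factors); only the β-part
(Δ² = `MCell.delta2` on every factor) is a G₁-type symmetry — `Pad4TowerDelta2Window` (p610008: Δ² ∕ S₄ wlog, `PhaseClosed`), `Pad4TowerTorusBlind`
(LEMMA T: torus translations) and `Pad4TowerPermCovariance` (LEMMA P) certify invariance under G₁-type moves, which neither swap the levels nor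
reverse α; they are orthogonal certificates, not inputs to Binder 1 or 2.
BINDER 2 has no kernel form for the intended class: the tree's typed models are `Pad4FirstOrderModel` (class-y `Design` ∕ `H2`, one layer per
constituent — tower cells such as `[8I ∣ x ∣ x ∣ x]` are not class-y) and `Pad4TowerLemmaA2I` ((F1ℝ) `Config`; the §17′ kill predicate `A2IDead` in
clean SUFFICIENT form — the «Z violates (E1)» conclusion is pencil). A class-y shadow (`SuppY` + design-level dual with `H2` transport, giving
Binder 1 as a theorem on the one-layer model) is A4-b, NOT NOW (critic: behind A11; it would not reach tower supports; width toward H2 = 0).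
REMARK (A4-c, pencil memo §4 «RULE-D supplies (O3)», not typed): on a RULE-D-closed support the b-lift `N = P(σ ↦ (α + c)·I)` of every charged letter
of a `P`-cell is present, so at an A♭_h head the partner at guard depth `d = cabs` exists and the demand row of memo §3 is the non-degenerate one;
a per-instance typing over `RuleDMu4Closed ∧ InDiamond h` is possible and unkeyed (A10).
Nothing in this table moves a census row or says anything about HC ∕ HC_AV ∕ `BlochSeedDiscOne`; the load-bearing object of the anomaly line is
the ◇₈ re-run under rule set (c) = H₁ + A♭₈ (critic A9), not this file. -/

/-- Binder 1 for the RULE-D class, any height (`ruleDMu4Closed_dual`). -/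
theorem conjugationPrinciple_ruleD (h : ℤ) : ConjugationPrinciple h RuleDMu4Closed :=
  fun C _ hD => (ruleDMu4Closed_dual h C).2 hD

/-- Binder 1 for the G₁ class, any height (`g1Closed_dual`). -/
theorem conjugationPrinciple_g1Closed (h : ℤ) : ConjugationPrinciple h MConfig.G1Closed :=
  fun _ _ hG => g1Closed_dual h hG

/-- Binder 1 for the diamond class itself, even height (`inDiamond_dual`). -/
theorem conjugationPrinciple_inDiamond {h : ℤ} (hh : h % 2 = 0) : ConjugationPrinciple h (fun C => C.InDiamond h) :=
  fun _ hC _ => inDiamond_dual hh hC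

/-- Binder 1 is closed under intersection of classes. -/
theorem conjugationPrinciple_and {h : ℤ} {S T : MConfig → Prop} (hS : ConjugationPrinciple h S) (hT : ConjugationPrinciple h T) :
    ConjugationPrinciple h (fun C => S C ∧ T C) :=
  fun C hC hST => ⟨hS C hC hST.1, hT C hC hST.2⟩

/-- the smallest typed ι₈-stable envelope in the tree: `RULE-D ∧ G₁ ∧ ◇₈`. -/
theorem conjugationPrinciple_envelope_eight :
    ConjugationPrinciple 8 (fun C => RuleDMu4Closed C ∧ C.G1Closed ∧ C.InDiamond 8) :=
  conjugationPrinciple_and (conjugationPrinciple_ruleD 8)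
    (conjugationPrinciple_and (conjugationPrinciple_g1Closed 8) (conjugationPrinciple_inDiamond (h := 8) (by decide)))

/-- **Binder 1 is FALSE for the bare A2I⁻ class of record at `h = 8`**: the survivor fragment `flatFrag8` lies in ◇₈, is `A2I⁻`-closed, and its
ι₈-image is not (`flatFrag8_probe`) — the chirality itself. Hence `LemmaA2IFlat 8` instantiated at `Supp := A2IMinusClosed` is vacuous. -/
theorem not_conjugationPrinciple_a2iMinus_eight : ¬ ConjugationPrinciple 8 A2IMinusClosed :=
  fun H => flatFrag8_probe.2.2.2.1 (H flatFrag8 flatFrag8_probe.1 flatFrag8_probe.2.2.2.2.1)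

/-- Binder 2 is dischargeable in tree only degenerately: for any class contained in the predicate. -/
theorem necessary_of_subclass {h : ℤ} {Supp Φ : MConfig → Prop} (hsub : ∀ C, Supp C → Φ C) : Necessary h Supp Φ :=
  fun C _ hS => hsub C hS

end AnomalyLens

end Summit.Ventures.HSemireg.Pad4Tower
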